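import Mathlib

/-!
# Ideator 1 (g4) sketch — crux `SkeletonJ1R` (stmt-NavierStokesRegularity-23610)

By-product statements of the DROPPED "least-squares closing" analysis (see
`Cruxes/SkeletonJ1R/MEMO-ideator1-g4.md`).  Mathlib only; every declaration is a `def`,
no `sorry`.  Nothing here is a route item.

* `rosenheadVariationKernel μ s = (2μ² − s²)(s² + μ²)^{-5/2}` — the kernel of the NONLOCAL part of
  the linearised regularised (Rosenhead–Moore) self-induction of a STRAIGHT filament: a normal
  displacement `ψ` of the line `σ ↦ σ t` changes the induced velocity at the axial point `τ t` by
  `(Γγ/4π) · ((G_μ ∗ ψ)(τ)) × t` (variation of `X′(σ) × (y − X(σ)) / (|y − X(σ)|² + μ²)^{3/2}` at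
  `y = τ t`, one integration by parts).  `∫ G_μ = 2/μ²` (the local swirl term cancels it for rigid
  translations).
* `StraightModelExteriorRigidity` — if `ψ ∈ L¹` is supported in `[a,b]` and `G_μ ∗ ψ` vanishes on an
  interval `(b, b')` OUTSIDE the support, then `ψ = 0` a.e.  Proof sketch (not formalised):
  `G_μ` extends holomorphically to the strip `|Im s| < μ`, hence so does `G_μ ∗ ψ`; vanishing on
  `(b,b')` forces `G_μ ∗ ψ ≡ 0` on `ℝ` (identity theorem); its Fourier transform `Ĝ_μ · ψ̂`
  vanishes, `Ĝ_μ` is real-analytic off `0` and not identically zero, `ψ̂` is entire ⇒ `ψ̂ ≡ 0`.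
  This is the straight-filament model of the "clamped-adjoint kernel is trivial at ANALYTIC
  skeletons" unique-continuation lemma recorded in the memo.
* `LeastSquaresClosingPrinciple` — the (folklore) closing step of the dropped line: an interior
  local minimiser of `‖G ·‖²` at which `fderiv G` has dense range is an exact zero of `G`.
  Recorded only to make precise WHICH step the memo's obstruction concerns (interiority on the free
  collar, not this principle).
-/

namespace Summit.NavierStokesRegularity.NavierStokesRegularity.Cruxes.SkeletonJ1R.LeastSquaresClosing

open MeasureTheory Set

/-- Nonlocal variation kernel of the regularised straight-filament self-induction,
`G_μ(s) = (2μ² − s²) / (s² + μ²)^{5/2}`. -/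
noncomputable def rosenheadVariationKernel (μ s : ℝ) : ℝ :=
  (2 * μ ^ 2 - s ^ 2) / (s ^ 2 + μ ^ 2) ^ ((5 : ℝ) / 2)

/-- STRAIGHT-MODEL EXTERIOR RIGIDITY (first checkable statement of the unique-continuation
by-product): an `L¹` normal displacement supported in `[a,b]` whose induced nonlocal velocity
variation vanishes on an interval `(b,b')` beyond the support is zero a.e. -/
def StraightModelExteriorRigidity : Prop :=
  ∀ (μ a b b' : ℝ), 0 < μ → a < b → b < b' →
  ∀ ψ : ℝ → ℝ, IntegrableOn ψ (Icc a b) → (∀ σ, σ ∉ Icc a b → ψ σ = 0) →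
  (∀ τ ∈ Ioo b b', ∫ σ in Icc a b, rosenheadVariationKernel μ (τ - σ) * ψ σ = 0) →
  ψ =ᵐ[volume] 0

/-- Folklore least-squares closing principle (real Hilbert target): an interior local minimiser of
the squared residual at which the derivative has dense range is an exact zero. -/
def LeastSquaresClosingPrinciple : Prop :=
  ∀ (E F : Type) [NormedAddCommGroup E] [NormedSpace ℝ E]
    [NormedAddCommGroup F] [InnerProductSpace ℝ F] (G : E → F) (x : E),
    DifferentiableAt ℝ G x → IsLocalMin (fun y => ‖G y‖ ^ 2) x →
    DenseRange (fderiv ℝ G x) → G x = 0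

end Summit.NavierStokesRegularity.NavierStokesRegularity.Cruxes.SkeletonJ1R.LeastSquaresClosing
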